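import Summits.BirchSwinnertonDyer.BirchSwinnertonDyer.Theorems.CountingDoorF2AtThreeRefinedDoorFamily
import HarnessLib

/-!
# BirchSwinnertonDyer / CountingDoorF2AtThree — the MINIMAL counting bridge `CountingBridgeMin` holds
# (closes support item stmt-BirchSwinnertonDyer-20019)

Route `route-BirchSwinnertonDyer-CountingDoorF2AtThree` (cell bsd-rank2; TWIN-axis leaf T-r2
`PAdicBSDRankTwoPositiveProportion`, rev 15). The support item `CountingBridgeMin` says that the
published inputs at `3` (`PublishedInputsAtThree`), the `3`-Selmer first moment I1
(`SelmerThreeAverageLargeF2`) and the root-number lower density I2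
(`RootNumberPlusLowerDensityLargeF2`) ALONE imply the leaf: the large-family inputs (Bhargava–Ho 2022
Thm. 9.1/10.1), generic members and Schneider non-degeneracy at `3` are discharged MEMBER-WISE on the
refined door family `Φ***` (`Theorems.exists_refinedDoorFamily_densities`), so the chain is the tree
theorem `Theorems.leaf_of_cruxes_without_largeFamilyInputs` (seat bsd-rank2-eng-2 GEN 3). This file is
the by-name closer: the theorem's type is literally the route decl.

THEOREMS ONLY (no definition, no named fact, no `sorry`). PARTITION: none — r_an ≥ 2, summit axis S0
(D-0036(1) funded rung); TWIN (D-0056): n/a. B1 honesty: term-level glue of landed tree theorems; the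
family-wise inputs I1/I2 and the published inputs at `3` stay hypotheses; nothing reads an analytic
rank; no S0 motion.

References: M. Bhargava, W. Ho, arXiv:2207.03309 Thm. 9.1/10.1 [BhargavaHo2022]; M. Bhargava,
A. Shankar, Ann. of Math. 181 (2015) §1 [BhargavaShankarTernary2015].
-/

set_option linter.dupNamespace false

namespace Summit.BirchSwinnertonDyer.BirchSwinnertonDyer.Theorems

/-- **The minimal counting bridge of route `CountingDoorF2AtThree` holds** (support item
stmt-BirchSwinnertonDyer-20019 `CountingBridgeMin`): the published inputs at `3`, I1 (average
`#Sel₃ ≤ 36` on every large `Φ ⊆ F₂`) and I2 (root number `+1` with lower density `> 1/6` on every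
large `Φ` with nonempty residue sets) imply the TWIN leaf `PAdicBSDRankTwoPositiveProportion`; after
unfolding this is `Theorems.leaf_of_cruxes_without_largeFamilyInputs` (the chain run on the refined
door family `Φ***`, where generic members, the local door conditions and Schneider at `3` hold for
every member). [cite: BhargavaShankarTernary2015, §1 (first-moment method with parity)]
[cite: BhargavaHo2022, Thm. 9.1 (§9.1, p. 31) and Thm. 10.1 (§10, p. 35)] -/
theorem countingBridgeMin :
    Summit.BirchSwinnertonDyer.BirchSwinnertonDyer.Theses.CountingDoorF2AtThree.CountingBridgeMin := by
  unfold Summit.BirchSwinnertonDyer.BirchSwinnertonDyer.Theses.CountingDoorF2AtThree.CountingBridgeMin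
  exact leaf_of_cruxes_without_largeFamilyInputs

end Summit.BirchSwinnertonDyer.BirchSwinnertonDyer.Theorems
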